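import Summits.ResolutionOfSingularities.ResolutionOfSingularities.Theorems.EquisingularLiftEquisingularLiftNatValuationChartCentreRing
import Summits.ResolutionOfSingularities.ResolutionOfSingularities.Theorems.EquisingularLiftEquisingularLiftNatValuationCentreBad
import Literature.AlgebraicGeometry.Resolution.BlowupPointBranches
import HarnessLib

/-!
# [OURS · L1 W4.5(b) · EL♮] K-VAL-CENTRE-UNIQ (U-2): after a RIBBON touch THE centre of the valuation on the blowing up is BAD
# — integral frame, in the currency of the tree's `IsBlowup.eq_of_stalkEmb_factors` (valuative criterion of separatedness)
# (crux `EquisingularLiftNat` = stmt-ResolutionOfSingularities-20038; PARENT ≥ 4 band / kill test #50 K5-BMY, DSHARP-VOID §2 (2a))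

HONEST FRAMING. OURS (cell res-hironaka, crux chain w45b, slot W4.5(b)); NOT a statement of any manuscript; replaces the role of
NOTHING in the manuscript; AI-written, AI review is weaker than expert review. Helper `--supports stmt-ResolutionOfSingularities-20038
--as helper`. Object «(U) K-VAL-CENTRE-UNIQ» of res-L1-w45b-plan-1's RULING 2026-08-27T20:06:38Z (res-D-brk-4 g9), piece (U-2) of the cut
announced 20:28:48Z; sequel of `…NatValuationChartCentre` (p563432), `…NatValuationCentreBad` (p565158), `…NatValuationChartCentreRing`
((U-1)).

THE POINT. The uniqueness of the centre of a valuation on a blowing up was already in the tree: `Literature/…/Resolution/BlowupPointBranches.lean`,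
`IsBlowup.eq_of_stalkEmb_factors` — for a blowing up `ρ : C′ → C` of an INTEGRAL locally Noetherian `C` (`IsSeparated ρ`, `C′` integral),
a point `x ∈ C` and a valuation ring `V ⊆ K(C)` dominating `𝒪_{C,x}` (`hV`, `hloc`), two points of `C′` over `x` whose local rings map
LOCALLY to `V` compatibly with the canonical embeddings `ε = IsBlowup.stalkEmb` coincide (existence: `exists_point_stalkEmb_mem`, `ρ`
proper). This file puts the (α) construction into that currency:

* `mem_maximalIdeal_iff_valuation_lt_one` — dominance dictionary: `t ∈ 𝔪_s ↔ V(t) < 1`.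
* `exists_point_bad_localHom_of_ribbon` — after a RIBBON touch at `s` (`ϖ_s − g ∈ 𝔪_s²`, `g` in the stalk ideal `(c)` of the centre,
  `c_j ∈ 𝔪_s` of minimal `V`-value, `V(g) > V(c_j)`): some `x′ ∈ X′` over `s` is BAD (germ of `ϖ` w.r.t. `π ≫ r` in `𝔪_{x′}²`) and
  carries a LOCAL `G : 𝒪_{X′,x′} → V` with `V.subtype ∘ G = hπ.stalkEmb x′` — by (U-1) `exists_localHom_valuationSubring` at the stalk
  presented by the compatible reader of p565158, and `IsBlowup.stalkEmb_unique`.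
* **`bad_of_isCentre_of_ribbon`** — hence, for `X′` integral and `π` separated, EVERY point `x″` over `s` dominated by `V` in the tree's
  sense is BAD: it equals `x′` by `IsBlowup.eq_of_stalkEmb_factors`. I.e. «after a ribbon touch THE `v`-centre sits at a bad point»,
  DSHARP-VOID §2 (2a), as a kernel theorem in the frame `ρ : Y_{j+1} → Y_j` (`Y_j` integral, `v` a valuation ring of `K(Y_j)`),
  with badness read in `𝒪_{Y_{j+1}}`.

RESIDUAL (U-3), stated precisely and NOT proved here: the AMBIENT reading of (2a) — `Y_j ⊂ P_j` a hypersurface of the regular ambient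
`P_j`, `Y_{j+1} ↪ P_{j+1}` its strict transform, badness read in `𝒪_{P_{j+1}, ι′(y′)}` (which is what (2c) of the memo consumes: the
centre `C_i ⊂ P_i` is a DVR quotient of `𝒪_{P_i}`, not of `𝒪_{Y_i}`) — needs the chart compatibility of the strict-transform closed
immersion (`BlowupStrictTransform.blowupAlgebraMap` / `BlowupAlgebraStrictTransform.mem_ker_blowupAlgebraMap_iff` at ring level,
`StrictTransformIsBlowup` / `IsBlowup.strictTransformHom` at scheme level): the `v`-centre of `Y_{j+1}` maps under `ι′` to the point of
`P_{j+1}` under the chart prime `𝔓_v` of p563432 (where p565158 proves ambient badness). The ring-level half of that statement is (U-1)'s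
`apply_eq_zero_iff_exists` (the support of `w` on the ambient chart is the strict-transform ideal).

References: [Kollar2007, §1.4]; [StacksProject, Tag 01KF, Tag 01KZ]; [ZariskiSamuel1960, Ch. VI §5, §17]; tree `…Resolution/BlowupPointBranches.lean`,
`…Resolution/BlowupStalkEmbedding.lean` (`IsBlowup.stalkEmb`, `stalkEmb_unique`, `algebraMap_comp_stalkSpecializes`), `…Resolution/ValuationCentre.lean`.
-/

set_option linter.dupNamespace false -- mandated namespace `Summit.<Summit>.<Problem>` of this single-conjunct summit

noncomputable section

universe u v

open IsLocalRing IsLocalization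
open Literature.AlgebraicGeometry.Resolution

namespace Summit.ResolutionOfSingularities.ResolutionOfSingularities.Cruxes.EquisingularLiftNat.Sections

namespace ValChartCentre

section Scheme

open CategoryTheory AlgebraicGeometry TopologicalSpace
open AlgebraicGeometry.Scheme.IdealSheafData

variable {X' X : Scheme.{0}} {π : X' ⟶ X} {J : X.IdealSheafData} [IsIntegral X] [IsLocallyNoetherian X]

omit [IsLocallyNoetherian X] in
/-- On a local ring dominated by a valuation ring `V ⊆ K(X)` (through `𝒪_{X,s} ⊆ K(X)`, the map `stalkToValuationSubring` being LOCAL):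
membership in `𝔪_s` is `V.valuation < 1`. [folklore] -/
theorem mem_maximalIdeal_iff_valuation_lt_one (s : X) (V : ValuationSubring X.functionField)
    (hV : ∀ t : X.presheaf.stalk s, algebraMap (X.presheaf.stalk s) X.functionField t ∈ V)
    (hloc : IsLocalHom (stalkToValuationSubring s V hV)) (t : X.presheaf.stalk s) :
    t ∈ maximalIdeal (X.presheaf.stalk s) ↔ V.valuation (algebraMap (X.presheaf.stalk s) X.functionField t) < 1 := by
  have e : (stalkToValuationSubring s V hV t : X.functionField) = algebraMap (X.presheaf.stalk s) X.functionField t := rfl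
  rw [← e, ← ValuationSubring.valuation_lt_one_iff, IsLocalRing.mem_maximalIdeal, IsLocalRing.mem_maximalIdeal,
    mem_nonunits_iff, mem_nonunits_iff]
  constructor
  · intro h hu
    exact h (hloc.map_nonunit t hu)
  · intro h hu
    exact h (hu.map _)

/-- **K-VAL-CENTRE-UNIQ (U-2), integral frame — after a RIBBON touch some point over `s` is BAD and DOMINATED BY `V` in the tree's
currency.** `X` integral locally Noetherian, `π : X′ → X` a blowing up along `J`, base `r : X → Spec O`, `ϖ ∈ O`; a point `s`,
generators `c` of `J_s` with `c_j ∈ 𝔪_s`, a member `g ∈ J_s` with `ϖ_s − g ∈ 𝔪_s²` (RIBBON); a valuation ring `V ⊆ K(X)` DOMINATING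
`𝒪_{X,s}` (`𝒪_{X,s} ⊆ V` with `stalkToValuationSubring` local — the hypotheses `hV`/`hloc` of `BlowupPointBranches.lean`) for which `c_j`
has MINIMAL `V`-value among the `c_i` and `V(g) > V(c_j)`. THEN some `x′ ∈ X′` over `s` is BAD (germ of `ϖ` w.r.t. `π ≫ r` in `𝔪_{x′}²`)
and carries a LOCAL homomorphism `G : 𝒪_{X′,x′} → V` inducing the canonical embedding `ε_{x′} : 𝒪_{X′,x′} ↪ K(X)`
(`V.subtype ∘ G = hπ.stalkEmb x′`) — the exact input of `IsBlowup.liftStruct_of_stalkEmb_factors` / `eq_of_stalkEmb_factors`.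
OURS. [folklore] -/
theorem exists_point_bad_localHom_of_ribbon {O : Type} [CommRing O] (r : X ⟶ Spec (.of O)) (ϖ : O)
    (hπ : IsBlowup π J) (s : X) {k : ℕ} (c : Fin k → X.presheaf.stalk s)
    (hc : Ideal.span (Set.range c) = stalkIdeal J s) (j : Fin k) (hcj : c j ∈ maximalIdeal (X.presheaf.stalk s))
    {g : X.presheaf.stalk s} (hg : g ∈ Ideal.span (Set.range c))
    (hrib : (X.presheaf.Γgerm s).hom (r.appTop.hom ((Scheme.ΓSpecIso (.of O)).inv.hom ϖ)) - g ∈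
      (maximalIdeal (X.presheaf.stalk s)) ^ 2)
    (V : ValuationSubring X.functionField)
    (hV : ∀ t : X.presheaf.stalk s, algebraMap (X.presheaf.stalk s) X.functionField t ∈ V)
    (hloc : IsLocalHom (stalkToValuationSubring s V hV))
    (hmin : ∀ i, V.valuation (algebraMap (X.presheaf.stalk s) X.functionField (c i)) ≤
      V.valuation (algebraMap (X.presheaf.stalk s) X.functionField (c j)))
    (hvg : V.valuation (algebraMap (X.presheaf.stalk s) X.functionField g) <
      V.valuation (algebraMap (X.presheaf.stalk s) X.functionField (c j))) :
    ∃ (x' : X'), π x' = s ∧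
      (X'.presheaf.Γgerm x').hom ((π ≫ r).appTop.hom ((Scheme.ΓSpecIso (.of O)).inv.hom ϖ)) ∈
        (maximalIdeal (X'.presheaf.stalk x')) ^ 2 ∧
      ∃ G : X'.presheaf.stalk x' →+* V, IsLocalHom G ∧ (V.subtype).comp G = hπ.stalkEmb x' := by
  -- the valuation `v = V.valuation ∘ (𝒪_{X,s} ⊆ K(X))` on the stalk, centred at `𝔪_s`
  let φ : X.presheaf.stalk s →+* X.functionField := algebraMap (X.presheaf.stalk s) X.functionField
  let v : Valuation (X.presheaf.stalk s) V.ValueGroup := V.valuation.comap φ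
  have hvφ : ∀ t, V.valuation (φ t) = v t := fun t => rfl
  have hR : ∀ t, v t ≤ 1 := fun t => V.valuation_le_one ⟨φ t, hV t⟩
  have hcent : ∀ t, v t < 1 ↔ t ∈ maximalIdeal (X.presheaf.stalk s) := fun t =>
    (mem_maximalIdeal_iff_valuation_lt_one s V hV hloc t).symm
  have ha : v (c j) ≠ 0 := (lt_of_le_of_lt zero_le hvg).ne'
  have hJ : ∀ x ∈ Ideal.span (Set.range c), v x ≤ v (c j) :=
    forall_mem_span_le v hR (by rintro _ ⟨i, rfl⟩; exact hmin i)
  obtain ⟨w, hw⟩ := exists_valuation_away v ha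
  obtain ⟨𝔓, hcomap, hM, hwg, h𝔓⟩ := exists_centre_ribbon v hR hcent ha hJ hw hg hvg
  -- the point under `𝔓_v`, with its structure map
  obtain ⟨x', hx, θ, hlocθ, hθ⟩ := exists_point_algebra_of_blowupAlgebra_prime hπ s c hc j 𝔓 hcomap
  refine ⟨x', hx, ?_, ?_⟩
  · -- BAD (as in `exists_point_bad_dominated_of_ribbon`)
    letI := θ.toAlgebra
    haveI : IsLocalization.AtPrime (X'.presheaf.stalk x') 𝔓.asIdeal := hlocθ
    have hbad := RibbonBad.algebraMap_mem_sq hcj hrib 𝔓.asIdeal hM hwg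
    have hθP : 𝔓.asIdeal.map θ ≤ maximalIdeal (X'.presheaf.stalk x') := by
      rw [Ideal.map_le_iff_le_comap]
      intro b hb
      rw [Ideal.mem_comap]
      exact (IsLocalization.AtPrime.to_map_mem_maximal_iff (X'.presheaf.stalk x') 𝔓.asIdeal b).mpr hb
    have key : θ (algebraMap _ (blowupAlgebra (Ideal.span (Set.range c)) (c j))
        ((X.presheaf.Γgerm s).hom (r.appTop.hom ((Scheme.ΓSpecIso (.of O)).inv.hom ϖ)))) ∈
        (maximalIdeal (X'.presheaf.stalk x')) ^ 2 := by
      have hle : (𝔓.asIdeal ^ 2).map θ ≤ (maximalIdeal (X'.presheaf.stalk x')) ^ 2 := by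
        rw [Ideal.map_pow]
        exact Ideal.pow_right_mono hθP 2
      exact hle (Ideal.mem_map_of_mem θ hbad)
    rw [hθ] at key
    rw [varpiGerm_comp r (π ≫ r) π rfl x' ϖ]
    have e : (X.presheaf.Γgerm (π x')).hom (r.appTop.hom ((Scheme.ΓSpecIso (.of O)).inv.hom ϖ)) =
        (X.presheaf.stalkSpecializes (specializes_of_eq hx)).hom
          ((X.presheaf.Γgerm s).hom (r.appTop.hom ((Scheme.ΓSpecIso (.of O)).inv.hom ϖ))) := by
      rw [TopCat.Presheaf.Γgerm, TopCat.Presheaf.Γgerm, TopCat.Presheaf.germ_stalkSpecializes_apply]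
    rw [e]
    exact key
  · -- the LOCAL homomorphism to `V`, inducing `ε_{x′}`
    letI := θ.toAlgebra
    haveI : IsLocalization.AtPrime (X'.presheaf.stalk x') 𝔓.asIdeal := hlocθ
    obtain ⟨G₀, hG₀loc, hG₀φ, -⟩ :=
      exists_localHom_valuationSubring v hw h𝔓 φ V.valuation hvφ hR ha hJ (X'.presheaf.stalk x')
    -- re-target `G₀` to `V = V.valuation.valuationSubring`
    have hOV : ∀ y : X.functionField, y ∈ V.valuation.valuationSubring ↔ y ∈ V := fun y => by
      rw [ValuationSubring.valuationSubring_valuation]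
    let G : X'.presheaf.stalk x' →+* V :=
      ((V.valuation.valuationSubring.subtype).comp G₀).codRestrict V.toSubring (fun y => (hOV _).mp (G₀ y).2)
    have hGcoe : ∀ y, (G y : X.functionField) = (G₀ y : X.functionField) := fun y => rfl
    have hGloc : IsLocalHom G := by
      refine ⟨fun y hy => hG₀loc.map_nonunit y ?_⟩
      -- a unit of `V` has valuation `1`, so `G₀ y` is a unit of the valuation ring of `V.valuation`
      rw [ValuationSubring.valuation_eq_one_iff] at hy
      by_contra hnu
      have hlt : V.valuation (G₀ y : X.functionField) < 1 :=
        (Valuation.mem_maximalIdeal_iff (v := V.valuation)).mp ((IsLocalRing.mem_maximalIdeal _).mpr hnu)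
      rw [← hGcoe] at hlt
      exact (lt_irrefl _) (hy ▸ hlt)
    refine ⟨G, hGloc, hπ.stalkEmb_unique x' _ (RingHom.ext fun a => ?_)⟩
    -- `V.subtype (G (π^♯ a)) = a` in `K(X)`: rebase `a` to the stalk at `s`
    have h₁ : s ⤳ π x' := specializes_of_eq hx.symm
    have e2 : (X.presheaf.stalkSpecializes (specializes_of_eq hx)).hom
        ((X.presheaf.stalkSpecializes h₁).hom a) = a := by
      rw [← CommRingCat.comp_apply, TopCat.Presheaf.stalkSpecializes_comp]
      rw [show X.presheaf.stalkSpecializes ((specializes_of_eq hx).trans h₁) = 𝟙 _ from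
        X.presheaf.stalkSpecializes_refl (π x')]
      rfl
    have e3 : (π.stalkMap x').hom a =
        θ (algebraMap _ (blowupAlgebra (Ideal.span (Set.range c)) (c j)) ((X.presheaf.stalkSpecializes h₁).hom a)) := by
      rw [hθ, e2]
    change ((G ((π.stalkMap x').hom a)) : X.functionField) = algebraMap (X.presheaf.stalk (π x')) X.functionField a
    rw [hGcoe, e3]
    have h4 := hG₀φ ((X.presheaf.stalkSpecializes h₁).hom a)
    rw [RingHom.algebraMap_toAlgebra] at h4
    rw [h4]
    exact RingHom.congr_fun (algebraMap_comp_stalkSpecializes h₁) a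

/-- **K-VAL-CENTRE-UNIQ (U-2) — after a RIBBON touch, THE centre of `V` on the blowing up over `s` is BAD** (integral frame). With
the data of `exists_point_bad_localHom_of_ribbon`, `X′` integral and `π` separated: EVERY point `x″ ∈ X′` over `s` dominated by `V`
in the tree's sense (a local `G″ : 𝒪_{X′,x″} → V` inducing `ε_{x″}`) is BAD — because by `IsBlowup.eq_of_stalkEmb_factors`
(`BlowupPointBranches.lean`, valuative criterion of separatedness) it IS the bad point of `exists_point_bad_localHom_of_ribbon`. (Such a
centre exists when `π` is proper: `IsBlowup.exists_point_stalkEmb_mem`.) This is DSHARP-VOID §2 (2a) «the `v`-centre jumps onto the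
bad line» as a kernel theorem in the frame `ρ : Y_{j+1} → Y_j` of an INTEGRAL `Y_j` with badness read inside `Y_{j+1}`; the AMBIENT
reading (badness in `𝒪_{P_{j+1}}`, `Y_{j+1} ↪ P_{j+1}` the strict transform) additionally needs the strict-transform closed-immersion
chart compatibility (`BlowupStrictTransform`/`StrictTransformIsBlowup`) — residual (U-3), not in this file. OURS. [folklore] -/
theorem bad_of_isCentre_of_ribbon [IsIntegral X'] [IsSeparated π] {O : Type} [CommRing O] (r : X ⟶ Spec (.of O)) (ϖ : O)
    (hπ : IsBlowup π J) (s : X) {k : ℕ} (c : Fin k → X.presheaf.stalk s)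
    (hc : Ideal.span (Set.range c) = stalkIdeal J s) (j : Fin k) (hcj : c j ∈ maximalIdeal (X.presheaf.stalk s))
    {g : X.presheaf.stalk s} (hg : g ∈ Ideal.span (Set.range c))
    (hrib : (X.presheaf.Γgerm s).hom (r.appTop.hom ((Scheme.ΓSpecIso (.of O)).inv.hom ϖ)) - g ∈
      (maximalIdeal (X.presheaf.stalk s)) ^ 2)
    (V : ValuationSubring X.functionField)
    (hV : ∀ t : X.presheaf.stalk s, algebraMap (X.presheaf.stalk s) X.functionField t ∈ V)
    (hloc : IsLocalHom (stalkToValuationSubring s V hV))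
    (hmin : ∀ i, V.valuation (algebraMap (X.presheaf.stalk s) X.functionField (c i)) ≤
      V.valuation (algebraMap (X.presheaf.stalk s) X.functionField (c j)))
    (hvg : V.valuation (algebraMap (X.presheaf.stalk s) X.functionField g) <
      V.valuation (algebraMap (X.presheaf.stalk s) X.functionField (c j)))
    {x'' : X'} (hx'' : π x'' = s) (G'' : X'.presheaf.stalk x'' →+* V) [IsLocalHom G'']
    (hG'' : (V.subtype).comp G'' = hπ.stalkEmb x'') :
    (X'.presheaf.Γgerm x'').hom ((π ≫ r).appTop.hom ((Scheme.ΓSpecIso (.of O)).inv.hom ϖ)) ∈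
      (maximalIdeal (X'.presheaf.stalk x'')) ^ 2 := by
  obtain ⟨x', hx, hbad, G, hGloc, hG⟩ :=
    exists_point_bad_localHom_of_ribbon r ϖ hπ s c hc j hcj hg hrib V hV hloc hmin hvg
  haveI := hGloc
  have e : x'' = x' := hπ.eq_of_stalkEmb_factors s V hV hloc hx'' hx G'' hG'' G hG
  subst e
  exact hbad

end Scheme

end ValChartCentre

end Summit.ResolutionOfSingularities.ResolutionOfSingularities.Cruxes.EquisingularLiftNat.Sections
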